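import Literature.AlgebraicGeometry.Motives.AlgPoints
import Literature.AlgebraicGeometry.Motives.AlgPointsProofs
import Mathlib.AlgebraicGeometry.ValuativeCriterion
import Mathlib.Analysis.Normed.Field.ProperSpace
import Mathlib.Order.Filter.FilterProduct
import Mathlib.RingTheory.Valuation.ValuationSubring
import HarnessLib

/-!
# `X(L)` is compact for `X` proper and `L` a local field (proof file)

Sibling proof file of `Literature/AlgebraicGeometry/Motives/AlgPoints.lean`. That file vendors as
a *named fact* `Literature.compactSpace_algPoints_of_isProper X L`: for a `k`-scheme `X` proper over `k`
and a locally compact non-trivially normed field `L ⊇ k`, the space `X(L)` of `L`-points with its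
strong topology `AlgPoints.instTopologicalSpace` is compact. This file **discharges that fact**
(`Literature.AlgebraicGeometry.Motives.compactSpace_algPoints_of_isProper_holds`) from Mathlib (the valuative criterion for
universally closed morphisms, `AlgebraicGeometry.UniversallyClosed.eq_valuativeCriterion`) and
the accepted `AlgPoints` API.

The printed sources state the result for `L = ℂ` with a proof through Chow's lemma (Mumford,
*Red Book* I §10 Thm. 2; Serre, GAGA §2 n°7 Prop. 6: «Pour qu'une variété algébrique `X` soit
complète, il faut et il suffit qu'elle soit compacte», proof (b): `X` complete is dominated by a
projective `Y`, which is compact) and, for general locally compact `L`, B. Conrad, *Weil and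
Grothendieck approaches to adelic points*, Enseign. Math. **58** (2012), §5 / Prop. 2.1. Chow's
lemma is not available; the proof below is the standard *valuative* argument (SGA1 XII
Prop. 3.2 (v) via EGA II 7.3.8; cf. Conrad, *loc. cit.*, proof of Prop. 4.4), run with an
ultrapower of `L` as the valued field.

## Proof

Let `𝒰` be an ultrafilter on `X(L)`; we find `P₀` with `𝒰 → P₀`
(`Literature.AlgebraicGeometry.Motives.AlgPoints.exists_ultrafilter_le_nhds`).

* `X` is quasi-compact, so some affine open `U = Spec A` has `U(L) ∈ 𝒰`
  (`Literature.AlgebraicGeometry.Motives.AlgPoints.exists_isAffineOpen_setOf_pt_mem_mem`).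
* Let `K := L^𝒰 = Germ 𝒰 L` be the ultrapower field (Mathlib `Filter.Germ.instField`) and
  `R ⊆ K` the ring of germs of `𝒰`-bounded functions (`Literature.AlgebraicGeometry.Motives.AlgPoints.Ultra.boundedSubring`), a
  valuation subring (for `f : X(L) → L` either `‖f‖ ≤ 1` or `‖f⁻¹‖ ≤ 1` holds `𝒰`-almost
  everywhere). Since closed balls of `L` are compact, bounded functions have `𝒰`-limits: the
  standard-part map `st : R → L` (`Literature.AlgebraicGeometry.Motives.AlgPoints.Ultra.st`) is a ring homomorphism.
* The tautological point: `a ↦` germ of `(P ↦ a(P))` is a ring map `A → K`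
  (`germRingHom`), whence a `K`-point `Q : Spec K → U ⊆ X` over `k`
  (`Literature.AlgebraicGeometry.Motives.AlgPoints.ofRingHom`). By the valuative criterion (`X → Spec k` is universally closed)
  it extends to `l : Spec R → X` over `k`.
* The closed point of `Spec R` maps to some affine open `V`, hence all of `Spec R` maps to `V`
  (`Scheme.preimage_eq_top_of_closedPoint_mem`), and `l` is given by a ring map `β : Γ(X, V) → R`.
  Put `P₀ :=` the `L`-point `st ∘ β : Γ(X, V) → L` of `V`.
* `𝒰 → P₀`: convergence to a point of `V(L)` is tested on the regular functions `a ∈ Γ(X, V)`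
  (`Literature.AlgebraicGeometry.Motives.AlgPoints.tendsto_nhds_iff_of_mem_affineOpen`, the weak-topology description of the strong
  topology on an affine open, Conrad Prop. 2.1). On a basic open `D(g) ⊆ U ∩ V` containing the
  image of `Spec K` one has `a = a'/gᵐ` with `a' ∈ A` (`exists_map_mul_pow_eq_algebraMap`),
  so the germ of `P ↦ a(P)` is `Q^*(a) = β(a) ∈ R`, whose standard part `a(P₀)` is by
  construction the `𝒰`-limit of `a(P)`.

## References

* D. Mumford, *The Red Book of Varieties and Schemes*, I §10, Thm. 2. [MumfordRedBook1999]
* B. Conrad, *Weil and Grothendieck approaches to adelic points*, Enseign. Math. (2) **58**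
  (2012), 61–97, Prop. 2.1, Prop. 4.4, §5. [ConradAdelicPoints2012]
* J.-P. Serre, *Géométrie algébrique et géométrie analytique*, Ann. Inst. Fourier **6** (1956),
  §2 n°7 Prop. 6. [SerreGAGA1956]
* A. Grothendieck, SGA1, Exp. XII Prop. 3.2 (v); EGA II (7.3.8) (valuative criterion).
-/

noncomputable section

universe u

open CategoryTheory AlgebraicGeometry Topology TopologicalSpace Filter

namespace Literature.AlgebraicGeometry.Motives

variable {k : Type u} [Field k]

/-! ### The structure map `k → Γ(X, U)` -/

namespace SchemeOver

/-- The scalars `k → Γ(X, U)` of a `k`-scheme `X` on an open `U`: pull back along `X → Spec k`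
and identify `Γ(Spec k, ⊤) = k`. [Hartshorne II Ex. 2.4] [folklore] -/
def scalarRingHom (X : SchemeOver k) (U : X.left.Opens) : k →+* Γ(X.left, U) :=
  (X.hom.appLE ⊤ U le_top).hom.comp (Scheme.ΓSpecIso (.of k)).inv.hom

/-- Unfolding of `scalarRingHom`. [folklore] -/
theorem scalarRingHom_apply (X : SchemeOver k) (U : X.left.Opens) (c : k) :
    scalarRingHom X U c = X.hom.appLE ⊤ U le_top ((Scheme.ΓSpecIso (.of k)).inv c) :=
  rfl

end SchemeOver

namespace AlgPoints

variable {X : SchemeOver k} {L : Type u} [Field L] [Algebra k L]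

/-- Evaluation at an `L`-point is `k`-linear: the scalar `c` takes the value `c` at every point
(`AlgPoints.eval_appLE_top`). [Hartshorne II Ex. 2.7] [folklore] -/
theorem eval_scalarRingHom (P : AlgPoints X L) {U : X.left.Opens} (h : P.pt ∈ U) (c : k) :
    P.eval U h (SchemeOver.scalarRingHom X U c) = algebraMap k L c := by
  rw [SchemeOver.scalarRingHom_apply, eval_appLE_top]
  congr 1
  exact Iso.inv_hom_id_apply _ _

/-! ### The `L'`-point attached to a ring homomorphism on an affine open -/

section OfRingHom

variable {L' : Type u} [Field L'] [Algebra k L'] {U : X.left.Opens} (hU : IsAffineOpen U)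
  (ψ : Γ(X.left, U) →+* L') (hψ : ψ.comp (SchemeOver.scalarRingHom X U) = algebraMap k L')

/-- **`U(L') = Hom_k(Γ(X, U), L')` for `U` affine**: the `L'`-point
`Spec L' → Spec Γ(X, U) = U ⊆ X` attached to a ring homomorphism `ψ : Γ(X, U) → L'` compatible
with the scalars (Mathlib `IsAffineOpen.fromSpec`; cf. `AlgPoints.exists_eval_eq`).
[Hartshorne II Ex. 2.7 and Prop. 2.3; Conrad, Prop. 2.1] [folklore] -/
def ofRingHom : AlgPoints X L' :=
  Over.homMk (Spec.map (CommRingCat.ofHom ψ) ≫ hU.fromSpec) (by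
    have h1 := IsAffineOpen.SpecMap_appLE_fromSpec X.hom (isAffineOpen_top _) hU
      (V := U) (U := ⊤) le_top
    rw [IsAffineOpen.fromSpec_top, Scheme.isoSpec_Spec_inv, ← Spec.map_comp] at h1
    change (Spec.map (CommRingCat.ofHom ψ) ≫ hU.fromSpec) ≫ X.hom =
      Spec.map (CommRingCat.ofHom (algebraMap k L'))
    rw [Category.assoc, ← h1, ← Spec.map_comp, ← hψ]
    rfl)

/-- The underlying morphism of `ofRingHom hU ψ _` is `Spec ψ ≫ (Spec Γ(X, U) = U ⊆ X)`.
[folklore] -/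
theorem ofRingHom_left :
    (ofRingHom hU ψ hψ).left = Spec.map (CommRingCat.ofHom ψ) ≫ hU.fromSpec :=
  rfl

/-- The point attached to `ψ : Γ(X, U) → L'` lies in `U`. [folklore] -/
theorem pt_ofRingHom_mem : (ofRingHom hU ψ hψ).pt ∈ U := by
  have : hU.fromSpec (Spec.map (CommRingCat.ofHom ψ) (IsLocalRing.closedPoint L')) ∈
      Set.range hU.fromSpec :=
    Set.mem_range_self _
  rwa [hU.range_fromSpec] at this

/-- Evaluation at the point attached to `ψ` is `ψ`. [Hartshorne II Ex. 2.7] [folklore] -/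
theorem eval_ofRingHom (h : (ofRingHom hU ψ hψ).pt ∈ U) (a : Γ(X.left, U)) :
    (ofRingHom hU ψ hψ).eval U h a = ψ a := by
  rw [eval_eq_appLE]
  change (Scheme.ΓSpecIso (.of L')).hom
    ((Spec.map (CommRingCat.ofHom ψ) ≫ hU.fromSpec).appLE U ⊤ _ a) = ψ a
  rw [Scheme.Hom.comp_appLE, hU.fromSpec_app_self]
  simp only [Category.assoc, Scheme.Hom.map_appLE]
  rw [CommRingCat.comp_apply, ΓSpecIso_hom_SpecMap_appLE_top]
  exact congrArg ψ (Iso.inv_hom_id_apply _ a)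

end OfRingHom

/-! ### Regular functions near a basic open: `f = a / gᵐ` -/

/-- On a basic open `D(g) ⊆ U` of an affine open `U`, a regular function `f` on an open
`W ⊇ D(g)` is a fraction: `f|_{D(g)} · g ^ m = a|_{D(g)}` for suitable `a ∈ Γ(X, U)`, `m : ℕ`
(`Γ(X, D(g)) = Γ(X, U)[1/g]`, Mathlib `IsAffineOpen.isLocalization_basicOpen`).
[Hartshorne II Prop. 2.2 (b)] [folklore] -/
theorem exists_map_mul_pow_eq_algebraMap {U : X.left.Opens} (hU : IsAffineOpen U)
    (g : Γ(X.left, U)) {W : X.left.Opens} (f : Γ(X.left, W)) (hgW : X.left.basicOpen g ≤ W) :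
    ∃ (a : Γ(X.left, U)) (m : ℕ), X.left.presheaf.map (homOfLE hgW).op f *
      algebraMap Γ(X.left, U) Γ(X.left, X.left.basicOpen g) g ^ m =
        algebraMap Γ(X.left, U) Γ(X.left, X.left.basicOpen g) a := by
  have := hU.isLocalization_basicOpen g
  obtain ⟨⟨a, ⟨_, m, rfl⟩⟩, hfa⟩ := IsLocalization.surj (Submonoid.powers g)
    (X.left.presheaf.map (homOfLE hgW).op f)
  exact ⟨a, m, by simpa only [map_pow] using hfa⟩

/-- If `f|_{D(g)} · g ^ m = a|_{D(g)}`, then `f(Q) = a(Q) / g(Q) ^ m` at every point `Q` of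
`D(g)` with values in any field. [Hartshorne II Prop. 2.2 (b)] [folklore] -/
theorem eval_eq_div_of_map_mul_pow_eq {U : X.left.Opens} (g a : Γ(X.left, U))
    {W : X.left.Opens} (f : Γ(X.left, W)) (hgW : X.left.basicOpen g ≤ W) (m : ℕ)
    (hfa : X.left.presheaf.map (homOfLE hgW).op f *
      algebraMap Γ(X.left, U) Γ(X.left, X.left.basicOpen g) g ^ m =
        algebraMap Γ(X.left, U) Γ(X.left, X.left.basicOpen g) a)
    (Q : AlgPoints X L) (hQ : Q.pt ∈ X.left.basicOpen g) :
    Q.eval W (hgW hQ) f = Q.eval U (X.left.basicOpen_le g hQ) a /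
      Q.eval U (X.left.basicOpen_le g hQ) g ^ m := by
  have hQU : Q.pt ∈ U := X.left.basicOpen_le g hQ
  have hg0 : Q.eval U hQU g ≠ 0 := (Q.pt_mem_basicOpen_iff hQU g).mp hQ
  have key := congrArg (Q.evalRingHom (X.left.basicOpen g) hQ) hfa
  simp only [map_mul, map_pow, evalRingHom_apply] at key
  rw [eval_algebraMap_basicOpen, eval_algebraMap_basicOpen, eval_map_homOfLE] at key
  rw [eq_div_iff (pow_ne_zero m hg0)]
  exact key

/-- `eval_eq_appLE` for a morphism `q` propositionally equal to the point (avoids dependent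
rewriting under `Scheme.Hom.appLE`). [Hartshorne II Ex. 2.7] [folklore] -/
theorem eval_eq_ΓSpecIso_appLE (P : AlgPoints X L) (U : X.left.Opens) (h : P.pt ∈ U)
    (f : Γ(X.left, U)) (q : Spec (.of L) ⟶ X.left) (hq : P.toSpecHom = q) (e : ⊤ ≤ q ⁻¹ᵁ U) :
    P.eval U h f = (Scheme.ΓSpecIso (.of L)).hom (q.appLE U ⊤ e f) := by
  subst hq
  exact eval_eq_appLE P U h f

/-! ### Germs of regular functions along an ultrafilter of points -/

/-- **The tautological `L^𝒰`-valued point of an affine open.** For an ultrafilter `𝒰` on `X(L)`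
containing `U(L)`, the ring homomorphism `Γ(X, U) → L^𝒰 = Germ 𝒰 L`, `a ↦` germ of
`P ↦ a(P)` (ring axioms hold `𝒰`-almost everywhere, namely on `U(L)`, where `P ↦ a(P)` is the
evaluation homomorphism `AlgPoints.evalRingHom`). [folklore] -/
def germRingHom (𝒰 : Ultrafilter (AlgPoints X L)) {U : X.left.Opens}
    (hU𝒰 : {P : AlgPoints X L | P.pt ∈ U} ∈ (𝒰 : Filter (AlgPoints X L))) :
    Γ(X.left, U) →+* Germ (𝒰 : Filter (AlgPoints X L)) L where
  toFun a := ((evalOrZero U a : AlgPoints X L → L) : Germ (𝒰 : Filter (AlgPoints X L)) L)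
  map_one' := by
    rw [← Germ.coe_one]
    refine Germ.coe_eq.mpr ?_
    filter_upwards [hU𝒰] with P hP
    rw [Pi.one_apply, evalOrZero_of_mem _ hP, ← evalRingHom_apply, map_one]
  map_mul' a b := by
    rw [← Germ.coe_mul]
    refine Germ.coe_eq.mpr ?_
    filter_upwards [hU𝒰] with P hP
    rw [Pi.mul_apply, evalOrZero_of_mem _ hP, evalOrZero_of_mem _ hP, evalOrZero_of_mem _ hP,
      ← evalRingHom_apply, ← evalRingHom_apply, ← evalRingHom_apply, map_mul]
  map_zero' := by
    rw [← Germ.coe_zero]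
    refine Germ.coe_eq.mpr ?_
    filter_upwards [hU𝒰] with P hP
    rw [Pi.zero_apply, evalOrZero_of_mem _ hP, ← evalRingHom_apply, map_zero]
  map_add' a b := by
    rw [← Germ.coe_add]
    refine Germ.coe_eq.mpr ?_
    filter_upwards [hU𝒰] with P hP
    rw [Pi.add_apply, evalOrZero_of_mem _ hP, evalOrZero_of_mem _ hP, evalOrZero_of_mem _ hP,
      ← evalRingHom_apply, ← evalRingHom_apply, ← evalRingHom_apply, map_add]

/-- `germRingHom 𝒰 _ a` is the germ of `P ↦ a(P)` (`AlgPoints.evalOrZero`). [folklore] -/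
theorem germRingHom_apply (𝒰 : Ultrafilter (AlgPoints X L)) {U : X.left.Opens}
    (hU𝒰 : {P : AlgPoints X L | P.pt ∈ U} ∈ (𝒰 : Filter (AlgPoints X L))) (a : Γ(X.left, U)) :
    germRingHom 𝒰 hU𝒰 a =
      ((evalOrZero U a : AlgPoints X L → L) : Germ (𝒰 : Filter (AlgPoints X L)) L) :=
  rfl

/-- `germRingHom` is compatible with the scalars: a constant `c ∈ k` goes to the constant germ.
[folklore] -/
theorem germRingHom_scalarRingHom (𝒰 : Ultrafilter (AlgPoints X L)) {U : X.left.Opens}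
    (hU𝒰 : {P : AlgPoints X L | P.pt ∈ U} ∈ (𝒰 : Filter (AlgPoints X L))) (c : k) :
    germRingHom 𝒰 hU𝒰 (SchemeOver.scalarRingHom X U c) =
      ((fun _ ↦ algebraMap k L c : AlgPoints X L → L) : Germ (𝒰 : Filter (AlgPoints X L)) L) := by
  refine Germ.coe_eq.mpr ?_
  filter_upwards [hU𝒰] with P hP
  rw [evalOrZero_of_mem _ hP, eval_scalarRingHom]

/-! ### The strong topology near a point of an affine open -/

section Nhds

variable [TopologicalSpace L] [IsTopologicalDivisionRing L] [T1Space L]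

/-- **Near a point of an affine open `U`, the strong topology is the weak topology of the
regular functions on `U`** (Conrad, Prop. 2.1: `X(R) = Hom_R(A, R) ⊆ R^A` with the subspace
topology; Serre, GAGA §2 n°5, Remarque: «la moins fine rendant continues les fonctions
régulières»). For `P ∈ U(L)`, `U` affine and `L` a `T₁` topological field, the neighbourhood
filter of `P` in `X(L)` is `𝓟 U(L) ⊓ ⨅_{a ∈ Γ(X, U)} comap a (𝓝 a(P))`. The inequality `≥` is the
content: a sub-basic open `{Q ∈ W(L) | f(Q) ∈ V} ∋ P` contains `{Q ∈ U(L) | a(Q) ∈ N₁, g(Q) ∈ N₂}`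
for a basic open `D(g) ⊆ W ∩ U` around `P.pt`, `f|_{D(g)} = a/gᵐ`, and neighbourhoods `N₁ ∋ a(P)`,
`N₂ ∋ g(P)` with `N₁ × N₂ ⊆ {(x, y) | y ≠ 0, x/yᵐ ∈ V}` (open as `L` is a `T₁` topological field).
[cite: ConradAdelicPoints2012, Prop. 2.1 (p. 2)] -/
theorem nhds_eq_of_mem_affineOpen {U : X.left.Opens} (hU : IsAffineOpen U) {P : AlgPoints X L}
    (hP : P.pt ∈ U) :
    𝓝 P = 𝓟 {Q : AlgPoints X L | Q.pt ∈ U} ⊓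
      ⨅ a : Γ(X.left, U), comap (evalOrZero U a) (𝓝 (evalOrZero U a P)) := by
  apply le_antisymm
  · refine le_inf (le_principal_iff.mpr ((isOpen_setOf_pt_mem U).mem_nhds hP)) (le_iInf fun a ↦ ?_)
    exact ((continuousOn_evalOrZero U a).continuousAt
      ((isOpen_setOf_pt_mem U).mem_nhds hP)).tendsto.le_comap
  · rw [instTopologicalSpace, nhds_generateFrom]
    refine le_iInf₂ fun s hs ↦ le_principal_iff.mpr ?_
    obtain ⟨hPs, W, f, V, hV, rfl⟩ := hs
    obtain ⟨hPW, hfP⟩ := hPs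
    -- a basic open `D(g) ⊆ W ∩ U` of `U` around `P.pt`
    obtain ⟨g, hgle, hPg⟩ :=
      hU.exists_basicOpen_le (V := W ⊓ U) ⟨P.pt, Opens.mem_inf.mpr ⟨hPW, hP⟩⟩ hP
    have hgW : X.left.basicOpen g ≤ W := hgle.trans inf_le_left
    obtain ⟨a, m, hfa⟩ := exists_map_mul_pow_eq_algebraMap hU g f hgW
    have hval := eval_eq_div_of_map_mul_pow_eq (L := L) g a f hgW m hfa
    have hgP : P.eval U hP g ≠ 0 := (P.pt_mem_basicOpen_iff hP g).mp hPg
    -- the open set `{(x, y) | y ≠ 0, x / y ^ m ∈ V}` of `L × L` contains `(a(P), g(P))`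
    have hN : {z : L × L | z.2 ≠ 0} ∩ (fun z : L × L ↦ z.1 / z.2 ^ m) ⁻¹' V ∈
        𝓝 (P.eval U hP a, P.eval U hP g) := by
      refine IsOpen.mem_nhds ?_ ⟨hgP, ?_⟩
      · refine ContinuousOn.isOpen_inter_preimage ?_
          (isOpen_compl_singleton.preimage continuous_snd) hV
        exact continuous_fst.continuousOn.div (continuous_snd.continuousOn.pow m)
          fun z hz ↦ pow_ne_zero m hz
      · show P.eval U hP a / P.eval U hP g ^ m ∈ V
        rw [← hval P hPg]
        exact hfP
    obtain ⟨N₁, hN₁, N₂, hN₂, hsub⟩ := mem_nhds_prod_iff.mp hN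
    have hmem : {Q : AlgPoints X L | Q.pt ∈ U} ∩ (evalOrZero U a ⁻¹' N₁ ∩ evalOrZero U g ⁻¹' N₂) ∈
        𝓟 {Q : AlgPoints X L | Q.pt ∈ U} ⊓
          ⨅ a : Γ(X.left, U), comap (evalOrZero U a) (𝓝 (evalOrZero U a P)) := by
      refine inter_mem_inf (mem_principal_self _) (inter_mem ?_ ?_)
      · refine mem_iInf_of_mem a (preimage_mem_comap ?_)
        rwa [evalOrZero_of_mem a hP]
      · refine mem_iInf_of_mem g (preimage_mem_comap ?_)
        rwa [evalOrZero_of_mem g hP]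
    refine mem_of_superset hmem ?_
    rintro Q ⟨hQU : Q.pt ∈ U, hQ₁, hQ₂⟩
    rw [Set.mem_preimage, evalOrZero_of_mem _ hQU] at hQ₁ hQ₂
    have hz := hsub (Set.mk_mem_prod hQ₁ hQ₂)
    simp only [Set.mem_inter_iff, Set.mem_setOf_eq, Set.mem_preimage] at hz
    have hQg : Q.pt ∈ X.left.basicOpen g := (Q.pt_mem_basicOpen_iff hQU g).mpr hz.1
    refine ⟨hgW hQg, ?_⟩
    rw [hval Q hQg]
    exact hz.2

/-- **Convergence in `X(L)` is convergence of the values of regular functions**: a filter of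
`L`-points converges to `P ∈ U(L)` (`U` affine) iff it is eventually in `U(L)` and `a(Pᵢ) → a(P)`
for every `a ∈ Γ(X, U)` (from `nhds_eq_of_mem_affineOpen`).
[cite: ConradAdelicPoints2012, Prop. 2.1 (p. 2)] -/
theorem tendsto_nhds_iff_of_mem_affineOpen {U : X.left.Opens} (hU : IsAffineOpen U)
    {P : AlgPoints X L} (hP : P.pt ∈ U) {α : Type*} {F : Filter α} {u : α → AlgPoints X L} :
    Tendsto u F (𝓝 P) ↔ (∀ᶠ i in F, (u i).pt ∈ U) ∧
      ∀ a : Γ(X.left, U), Tendsto (fun i ↦ evalOrZero U a (u i)) F (𝓝 (P.eval U hP a)) := by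
  rw [nhds_eq_of_mem_affineOpen hU hP, tendsto_inf, tendsto_principal, tendsto_iInf]
  refine and_congr Iff.rfl (forall_congr' fun a ↦ ?_)
  rw [tendsto_comap_iff, evalOrZero_of_mem a hP]
  rfl

end Nhds

/-! ### Quasi-compactness: some affine chart is `𝒰`-large -/

/-- If the scheme `X` is quasi-compact, every ultrafilter on `X(L)` contains `U(L)` for some
affine open `U` (finitely many affine opens cover `X`, and `X(L) = ⋃ U(L)`). [folklore] -/
theorem exists_isAffineOpen_setOf_pt_mem_mem [TopologicalSpace L] [CompactSpace X.left]
    (𝒰 : Ultrafilter (AlgPoints X L)) :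
    ∃ U : X.left.Opens, IsAffineOpen U ∧ {P : AlgPoints X L | P.pt ∈ U} ∈ (𝒰 : Filter _) := by
  obtain ⟨t, ht⟩ := isCompact_univ.elim_finite_subcover
    (fun U : X.left.affineOpens ↦ ((U : X.left.Opens) : Set X.left)) (fun U ↦ U.1.isOpen)
    (fun x _ ↦ by
      obtain ⟨_, ⟨U, hU, rfl⟩, hxU, -⟩ :=
        X.left.isBasis_affineOpens.exists_subset_of_mem_open (Set.mem_univ x) isOpen_univ
      exact Set.mem_iUnion.mpr ⟨⟨U, hU⟩, hxU⟩)
  have hcov : (⋃ U ∈ (t : Set X.left.affineOpens),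
      {P : AlgPoints X L | P.pt ∈ (U : X.left.Opens)}) = Set.univ := by
    refine Set.eq_univ_of_forall fun P ↦ ?_
    have hP := ht (Set.mem_univ P.pt)
    simp only [Set.mem_iUnion] at hP
    obtain ⟨U, hUt, hPU⟩ := hP
    exact Set.mem_biUnion (Finset.mem_coe.mpr hUt) hPU
  have hmem : (⋃ U ∈ (t : Set X.left.affineOpens),
      {P : AlgPoints X L | P.pt ∈ (U : X.left.Opens)}) ∈ (𝒰 : Filter _) := by
    rw [hcov]
    exact univ_mem
  obtain ⟨U, -, hU⟩ := (Ultrafilter.finite_biUnion_mem_iff t.finite_toSet).mp hmem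
  exact ⟨U, U.2, hU⟩

/-! ### The ultrapower field `L^𝒰` and its ring of bounded germs -/

namespace Ultra

variable {S : Type u} (𝒰 : Ultrafilter S) (L : Type u) [NontriviallyNormedField L]

/-- **The valuation ring of bounded germs** `R ⊆ K = L^𝒰`: germs of functions `S → L` bounded
`𝒰`-almost everywhere. It is a valuation subring of the ultrapower field `K`
(Mathlib `Filter.Germ.instField`): for every `f`, either `‖f‖ ≤ 1` or `‖f‖ > 1` (so
`‖f⁻¹‖ ≤ 1`) holds on a member of the ultrafilter. [folklore] -/
def boundedSubring : ValuationSubring (Germ (𝒰 : Filter S) L) where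
  carrier := {x | ∃ C : ℝ, Germ.LiftPred (fun v : L ↦ ‖v‖ ≤ C) x}
  mul_mem' {x y} hx hy := by
    revert hx hy
    refine Germ.inductionOn₂ x y fun f g ↦ ?_
    rintro ⟨C, hC⟩ ⟨D, hD⟩
    rw [Germ.liftPred_coe] at hC hD
    refine ⟨C * D, ?_⟩
    rw [← Germ.coe_mul, Germ.liftPred_coe]
    filter_upwards [hC, hD] with s hs hs'
    rw [Pi.mul_apply, norm_mul]
    exact mul_le_mul hs hs' (norm_nonneg _) ((norm_nonneg _).trans hs)
  one_mem' := ⟨1, by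
    rw [← Germ.coe_one, Germ.liftPred_coe]
    exact Eventually.of_forall fun s ↦ by simp⟩
  add_mem' {x y} hx hy := by
    revert hx hy
    refine Germ.inductionOn₂ x y fun f g ↦ ?_
    rintro ⟨C, hC⟩ ⟨D, hD⟩
    rw [Germ.liftPred_coe] at hC hD
    refine ⟨C + D, ?_⟩
    rw [← Germ.coe_add, Germ.liftPred_coe]
    filter_upwards [hC, hD] with s hs hs'
    exact (norm_add_le _ _).trans (add_le_add hs hs')
  zero_mem' := ⟨0, by
    rw [← Germ.coe_zero, Germ.liftPred_coe]
    exact Eventually.of_forall fun s ↦ by simp⟩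
  neg_mem' {x} hx := by
    revert hx
    refine Germ.inductionOn x fun f ↦ ?_
    rintro ⟨C, hC⟩
    rw [Germ.liftPred_coe] at hC
    refine ⟨C, ?_⟩
    rw [← Germ.coe_neg, Germ.liftPred_coe]
    filter_upwards [hC] with s hs
    rwa [Pi.neg_apply, norm_neg]
  mem_or_inv_mem' x := by
    refine Germ.inductionOn x fun f ↦ ?_
    rcases 𝒰.em fun s ↦ ‖f s‖ ≤ 1 with h | h
    · exact Or.inl ⟨1, Germ.liftPred_coe.mpr h⟩
    · refine Or.inr ⟨1, ?_⟩
      rw [← Germ.coe_inv, Germ.liftPred_coe]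
      filter_upwards [h] with s hs
      rw [Pi.inv_apply, norm_inv]
      exact inv_le_one_of_one_le₀ (le_of_lt (not_le.mp hs))

/-- Membership of a germ `↑f` in the ring of bounded germs. [folklore] -/
theorem coe_mem_boundedSubring_iff (f : S → L) :
    (f : Germ (𝒰 : Filter S) L) ∈ boundedSubring 𝒰 L ↔ ∃ C : ℝ, ∀ᶠ s in (𝒰 : Filter S),
      ‖f s‖ ≤ C := by
  change (∃ C : ℝ, Germ.LiftPred (fun v : L ↦ ‖v‖ ≤ C) (f : Germ (𝒰 : Filter S) L)) ↔ _
  simp only [Germ.liftPred_coe]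

/-- Constant germs are bounded. [folklore] -/
theorem const_mem_boundedSubring (c : L) :
    ((fun _ : S ↦ c : S → L) : Germ (𝒰 : Filter S) L) ∈ boundedSubring 𝒰 L :=
  (coe_mem_boundedSubring_iff 𝒰 L _).mpr ⟨‖c‖, Eventually.of_forall fun _ ↦ le_rfl⟩

/-- The constants `L → R`, `c ↦` germ of the constant function `c`, as a ring homomorphism.
[folklore] -/
def constRingHom : L →+* boundedSubring 𝒰 L where
  toFun c := ⟨((fun _ : S ↦ c : S → L) : Germ (𝒰 : Filter S) L), const_mem_boundedSubring 𝒰 L c⟩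
  map_one' := rfl
  map_mul' _ _ := rfl
  map_zero' := rfl
  map_add' _ _ := rfl

/-- The germ underlying `constRingHom c` is the constant germ. [folklore] -/
@[simp]
theorem coe_constRingHom (c : L) :
    ((constRingHom 𝒰 L c : boundedSubring 𝒰 L) : Germ (𝒰 : Filter S) L) =
      ((fun _ : S ↦ c : S → L) : Germ (𝒰 : Filter S) L) :=
  rfl

variable [LocallyCompactSpace L]

/-- A `𝒰`-bounded function into the locally compact field `L` has a `𝒰`-limit (closed balls
are compact: Mathlib `ProperSpace.of_nontriviallyNormedField_of_weaklyLocallyCompactSpace`).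
[folklore] -/
theorem exists_tendsto_of_norm_le (f : S → L) (C : ℝ) (hf : ∀ᶠ s in (𝒰 : Filter S), ‖f s‖ ≤ C) :
    ∃ x : L, Tendsto f (𝒰 : Filter S) (𝓝 x) := by
  haveI : ProperSpace L := ProperSpace.of_nontriviallyNormedField_of_weaklyLocallyCompactSpace L
  have hK : IsCompact (Metric.closedBall (0 : L) C) := isCompact_closedBall 0 C
  have hle : ((𝒰.map f : Ultrafilter L) : Filter L) ≤ 𝓟 (Metric.closedBall (0 : L) C) := by
    rw [le_principal_iff, Ultrafilter.coe_map, mem_map]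
    filter_upwards [hf] with s hs
    simpa only [Set.mem_preimage, Metric.mem_closedBall, dist_zero_right] using hs
  obtain ⟨x, -, hx⟩ := hK.ultrafilter_le_nhds (𝒰.map f) hle
  exact ⟨x, by rwa [Ultrafilter.coe_map] at hx⟩

/-- The `𝒰`-limit of (a chosen representative of) a germ; meaningful on bounded germs
(`tendsto_ulim`). [folklore] -/
def ulim (x : Germ (𝒰 : Filter S) L) : L :=
  limUnder (𝒰 : Filter S) (Classical.choose (Quot.exists_rep x))

/-- **Bounded germs converge to their `𝒰`-limit**: if `↑f = x` is a bounded germ then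
`f → ulim x` along `𝒰`. [folklore] -/
theorem tendsto_ulim {x : Germ (𝒰 : Filter S) L} (hx : x ∈ boundedSubring 𝒰 L) {f : S → L}
    (hfx : (f : Germ (𝒰 : Filter S) L) = x) : Tendsto f (𝒰 : Filter S) (𝓝 (ulim 𝒰 L x)) := by
  set r : S → L := Classical.choose (Quot.exists_rep x) with hr_def
  have hr : (r : Germ (𝒰 : Filter S) L) = x := by
    rw [← Germ.quot_mk_eq_coe]
    exact Classical.choose_spec (Quot.exists_rep x)
  have hrf : r =ᶠ[(𝒰 : Filter S)] f := Germ.coe_eq.mp (hr.trans hfx.symm)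
  rw [← hfx, coe_mem_boundedSubring_iff] at hx
  obtain ⟨C, hC⟩ := hx
  have hC' : ∀ᶠ s in (𝒰 : Filter S), ‖r s‖ ≤ C := by
    filter_upwards [hrf, hC] with s h1 h2
    rwa [h1]
  have h1 : Tendsto r (𝒰 : Filter S) (𝓝 (ulim 𝒰 L x)) :=
    tendsto_nhds_limUnder (exists_tendsto_of_norm_le 𝒰 L r C hC')
  exact h1.congr' hrf

/-- The `𝒰`-limit of a bounded germ is characterised by convergence of any representative.
[folklore] -/
theorem ulim_eq_of_tendsto {x : Germ (𝒰 : Filter S) L} (hx : x ∈ boundedSubring 𝒰 L)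
    {f : S → L} (hfx : (f : Germ (𝒰 : Filter S) L) = x) {y : L}
    (hy : Tendsto f (𝒰 : Filter S) (𝓝 y)) : ulim 𝒰 L x = y :=
  tendsto_nhds_unique (tendsto_ulim 𝒰 L hx hfx) hy

/-- **The standard-part map** `st : R → L` on bounded germs, `x ↦` the `𝒰`-limit of any
representative; a ring homomorphism (limits of sums and products). [folklore] -/
def st : boundedSubring 𝒰 L →+* L where
  toFun x := ulim 𝒰 L (x : Germ (𝒰 : Filter S) L)
  map_one' := ulim_eq_of_tendsto 𝒰 L (boundedSubring 𝒰 L).one_mem (f := fun _ ↦ 1) rfl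
    tendsto_const_nhds
  map_mul' x y := by
    obtain ⟨f, hf⟩ := Quot.exists_rep (x : Germ (𝒰 : Filter S) L)
    obtain ⟨g, hg⟩ := Quot.exists_rep (y : Germ (𝒰 : Filter S) L)
    rw [Germ.quot_mk_eq_coe] at hf hg
    refine ulim_eq_of_tendsto 𝒰 L ((boundedSubring 𝒰 L).mul_mem _ _ x.2 y.2) (f := f * g)
      (by rw [Germ.coe_mul, hf, hg]) ?_
    exact (tendsto_ulim 𝒰 L x.2 hf).mul (tendsto_ulim 𝒰 L y.2 hg)
  map_zero' := ulim_eq_of_tendsto 𝒰 L (boundedSubring 𝒰 L).zero_mem (f := fun _ ↦ 0) rfl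
    tendsto_const_nhds
  map_add' x y := by
    obtain ⟨f, hf⟩ := Quot.exists_rep (x : Germ (𝒰 : Filter S) L)
    obtain ⟨g, hg⟩ := Quot.exists_rep (y : Germ (𝒰 : Filter S) L)
    rw [Germ.quot_mk_eq_coe] at hf hg
    refine ulim_eq_of_tendsto 𝒰 L ((boundedSubring 𝒰 L).add_mem _ _ x.2 y.2) (f := f + g)
      (by rw [Germ.coe_add, hf, hg]) ?_
    exact (tendsto_ulim 𝒰 L x.2 hf).add (tendsto_ulim 𝒰 L y.2 hg)

/-- `st x` is the `𝒰`-limit of any representative of `x`. [folklore] -/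
theorem tendsto_st (x : boundedSubring 𝒰 L) {f : S → L}
    (hfx : (f : Germ (𝒰 : Filter S) L) = (x : Germ (𝒰 : Filter S) L)) :
    Tendsto f (𝒰 : Filter S) (𝓝 (st 𝒰 L x)) :=
  tendsto_ulim 𝒰 L x.2 hfx

/-- The standard part of a constant is the constant. [folklore] -/
@[simp]
theorem st_constRingHom (c : L) : st 𝒰 L (constRingHom 𝒰 L c) = c :=
  ulim_eq_of_tendsto 𝒰 L (const_mem_boundedSubring 𝒰 L c) rfl tendsto_const_nhds

end Ultra

/-! ### Proper schemes: every ultrafilter of points converges -/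

section Main

variable {X : SchemeOver k} {L : Type u} [NontriviallyNormedField L] [Algebra k L]
  [LocallyCompactSpace L]

open Ultra in
/-- **Every ultrafilter on `X(L)` converges, for `X → Spec k` universally closed** and `L ⊇ k` a
locally compact non-trivially normed field. Given an ultrafilter `𝒰` containing `U(L)` for an
affine open `U` (always available when `X` is quasi-compact,
`exists_isAffineOpen_setOf_pt_mem_mem`): the tautological point `Spec L^𝒰 → U ⊆ X`
(`germRingHom`) extends, by the valuative criterion
(`AlgebraicGeometry.UniversallyClosed.eq_valuativeCriterion`) applied to the valuation ring `R` of
bounded germs (`Ultra.boundedSubring`), to `l : Spec R → X`; `Spec R` lands in an affine open `V`,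
`l` is a ring map `β : Γ(X, V) → R`, and `𝒰` converges to the `L`-point `st ∘ β` of `V`
(`Ultra.st` the standard part), because for `a ∈ Γ(X, V)` the germ of `P ↦ a(P)` is `β(a)`
(computed on a basic open `D(g) ⊆ U ∩ V`, where `a = a'/gᵐ`). This is the valuative proof of
«proper ⇒ `X(L)` compact» [SGA1 XII Prop. 3.2 (v) via EGA II 7.3.8; Conrad, Prop. 4.4 and §5;
Mumford I §10 Thm. 2 and Serre GAGA Prop. 6 prove the case `L = ℂ` through Chow's lemma].
[cite: ConradAdelicPoints2012, Prop. 2.1 and §5] -/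
theorem exists_ultrafilter_le_nhds [UniversallyClosed X.hom] (𝒰 : Ultrafilter (AlgPoints X L))
    {U : X.left.Opens} (hU : IsAffineOpen U)
    (hU𝒰 : {P : AlgPoints X L | P.pt ∈ U} ∈ (𝒰 : Filter (AlgPoints X L))) :
    ∃ P₀ : AlgPoints X L, (𝒰 : Filter (AlgPoints X L)) ≤ 𝓝 P₀ := by
  -- the ultrapower field `K = L^𝒰`, its valuation ring `R` of bounded germs
  let K : Type u := Germ (𝒰 : Filter (AlgPoints X L)) L
  let R : ValuationSubring K := boundedSubring 𝒰 L
  letI : Algebra k R := ((constRingHom 𝒰 L).comp (algebraMap k L)).toAlgebra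
  letI : Algebra k K := ((algebraMap R K).comp (algebraMap k R)).toAlgebra
  have halgK : ∀ c : k, algebraMap k K c =
      ((fun _ ↦ algebraMap k L c : AlgPoints X L → L) : K) := fun c ↦ rfl
  have halgRK : (algebraMap R K).comp (algebraMap k R) = algebraMap k K := rfl
  -- the tautological `K`-point `Q` of `U`
  let τ : Γ(X.left, U) →+* K := germRingHom 𝒰 hU𝒰
  have hτ : ∀ a, τ a = ((evalOrZero U a : AlgPoints X L → L) : K) := fun a ↦ rfl
  have hτk : τ.comp (SchemeOver.scalarRingHom X U) = algebraMap k K :=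
    RingHom.ext fun c ↦ (germRingHom_scalarRingHom 𝒰 hU𝒰 c).trans (halgK c).symm
  let Q : AlgPoints X K := ofRingHom hU τ hτk
  have hQU : Q.pt ∈ U := pt_ofRingHom_mem hU τ hτk
  have hQeval : ∀ a, Q.eval U hQU a = τ a := eval_ofRingHom hU τ hτk hQU
  -- valuative criterion: `Q` extends to `l : Spec R → X` over `k`
  have hE : ValuativeCriterion.Existence X.hom := by
    have h : UniversallyClosed X.hom := inferInstance
    rw [UniversallyClosed.eq_valuativeCriterion] at h
    exact h.1
  let sq : ValuativeCommSq X.hom :=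
    { R := R
      K := K
      i₁ := Q.toSpecHom
      i₂ := Spec.map (CommRingCat.ofHom (algebraMap k R))
      commSq := ⟨by
        rw [← Spec.map_comp, ← CommRingCat.ofHom_comp, halgRK]
        exact Over.w Q⟩ }
  obtain ⟨⟨l, hl₁, hl₂⟩⟩ := (hE sq).exists_lift
  change Spec.map (CommRingCat.ofHom (algebraMap R K)) ≫ l = Q.toSpecHom at hl₁
  change l ≫ X.hom = Spec.map (CommRingCat.ofHom (algebraMap k R)) at hl₂
  -- all of `Spec R` maps into an affine open `V ∋ l (closed point)`
  obtain ⟨_, ⟨V, hV, rfl⟩, hx₀V, -⟩ := X.left.isBasis_affineOpens.exists_subset_of_mem_open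
    (Set.mem_univ (l (IsLocalRing.closedPoint R))) isOpen_univ
  have hlV : l ⁻¹ᵁ V = ⊤ := Scheme.preimage_eq_top_of_closedPoint_mem l hx₀V
  have hlV' : ∀ z, l.base z ∈ V := fun z ↦ by
    have hz : z ∈ l ⁻¹ᵁ V := by rw [hlV]; trivial
    exact hz
  -- `l` is a ring map `β : Γ(X, V) → R`, compatible with the scalars
  let β : Γ(X.left, V) →+* R := (l.appLE V ⊤ hlV.ge ≫ (Scheme.ΓSpecIso (.of R)).hom).hom
  have hβ : ∀ a, β a = (Scheme.ΓSpecIso (.of R)).hom (l.appLE V ⊤ hlV.ge a) := fun a ↦ rfl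
  have hβk : β.comp (SchemeOver.scalarRingHom X V) = algebraMap k R := by
    refine RingHom.ext fun c ↦ ?_
    rw [RingHom.comp_apply, hβ, SchemeOver.scalarRingHom_apply]
    have h1 := ConcreteCategory.congr_hom
      (Scheme.Hom.appLE_comp_appLE l X.hom ⊤ V ⊤ le_top hlV.ge) ((Scheme.ΓSpecIso (.of k)).inv c)
    rw [CommRingCat.comp_apply] at h1
    rw [h1]
    have key : ∀ (g : Spec (.of R) ⟶ Spec (.of k)),
        g = Spec.map (CommRingCat.ofHom (algebraMap k R)) → ∀ e s,
        (Scheme.ΓSpecIso (.of R)).hom (g.appLE ⊤ ⊤ e s) =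
          algebraMap k R ((Scheme.ΓSpecIso (.of k)).hom s) := by
      rintro _ rfl e s
      exact ΓSpecIso_hom_SpecMap_appLE_top _ e s
    rw [key _ hl₂]
    exact congrArg (algebraMap k R) (Iso.inv_hom_id_apply (Scheme.ΓSpecIso (.of k)) c)
  -- the limit point: the `L`-point `st ∘ β` of `V`
  have hP₀k : ((st 𝒰 L).comp β).comp (SchemeOver.scalarRingHom X V) = algebraMap k L := by
    rw [RingHom.comp_assoc, hβk]
    exact RingHom.ext fun c ↦ st_constRingHom 𝒰 L (algebraMap k L c)
  let P₀ : AlgPoints X L := ofRingHom hV ((st 𝒰 L).comp β) hP₀k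
  have hP₀V : P₀.pt ∈ V := pt_ofRingHom_mem hV _ hP₀k
  have hP₀eval : ∀ a, P₀.eval V hP₀V a = st 𝒰 L (β a) := fun a ↦
    eval_ofRingHom hV _ hP₀k hP₀V a
  refine ⟨P₀, ?_⟩
  -- `Q` factors through `l`: `Q` lands in `V` and `Q^*(a) = β a` in `K` for `a ∈ Γ(X, V)`
  have hQl : Q.toSpecHom = Spec.map (CommRingCat.ofHom (algebraMap R K)) ≫ l := hl₁.symm
  have hQV : Q.pt ∈ V := by
    have hpt : Q.pt = l.base ((Spec.map (CommRingCat.ofHom (algebraMap R K))).base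
        (IsLocalRing.closedPoint K)) := by
      change Q.toSpecHom.base (IsLocalRing.closedPoint K) = _
      rw [hQl]
      rfl
    rw [hpt]
    exact hlV' _
  have hβK : ∀ a : Γ(X.left, V), ((β a : R) : K) = Q.eval V hQV a := by
    intro a
    have e' : (⊤ : (Spec (.of K)).Opens) ≤
        (Spec.map (CommRingCat.ofHom (algebraMap R K)) ≫ l) ⁻¹ᵁ V := by
      rw [← hQl]
      exact (Q.preimage_eq_top hQV).ge
    rw [eval_eq_ΓSpecIso_appLE Q V hQV a _ hQl e']
    have h2 : (Spec.map (CommRingCat.ofHom (algebraMap R K))).appLE ⊤ ⊤ le_top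
        (l.appLE V ⊤ hlV.ge a) =
        (Spec.map (CommRingCat.ofHom (algebraMap R K)) ≫ l).appLE V ⊤ e' a := by
      have := ConcreteCategory.congr_hom (Scheme.Hom.appLE_comp_appLE
        (Spec.map (CommRingCat.ofHom (algebraMap R K))) l V ⊤ ⊤ hlV.ge le_top) a
      rwa [CommRingCat.comp_apply] at this
    rw [← h2, ΓSpecIso_hom_SpecMap_appLE_top]
    rfl
  -- a basic open `D(g) ⊆ U ∩ V` through `Q`
  obtain ⟨g, hgle, hQg⟩ :=
    hU.exists_basicOpen_le (V := U ⊓ V) ⟨Q.pt, Opens.mem_inf.mpr ⟨hQU, hQV⟩⟩ hQU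
  have hgU : X.left.basicOpen g ≤ U := X.left.basicOpen_le g
  have hgV : X.left.basicOpen g ≤ V := hgle.trans inf_le_right
  -- `g ≠ 0` in `K`: `𝒰`-almost all `P` lie in `D(g) ⊆ V`
  have hg𝒰 : ∀ᶠ P in (𝒰 : Filter (AlgPoints X L)), P.pt ∈ X.left.basicOpen g := by
    have hgK : τ g ≠ 0 := by
      rw [← hQeval]
      exact (Q.pt_mem_basicOpen_iff hQU g).mp hQg
    have hne : ¬ ∀ᶠ P in (𝒰 : Filter (AlgPoints X L)), evalOrZero U g P = 0 := fun h ↦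
      hgK (by rw [hτ, ← Germ.coe_zero]; exact Germ.coe_eq.mpr h)
    filter_upwards [Ultrafilter.eventually_not.mpr hne, hU𝒰] with P hP hPU
    rw [evalOrZero_of_mem g hPU] at hP
    exact (P.pt_mem_basicOpen_iff hPU g).mpr hP
  -- convergence to `P₀ ∈ V(L)` is tested on the regular functions on `V`
  change Tendsto id (𝒰 : Filter (AlgPoints X L)) (𝓝 P₀)
  rw [tendsto_nhds_iff_of_mem_affineOpen hV hP₀V]
  refine ⟨hg𝒰.mono fun P hP ↦ hgV hP, fun a ↦ ?_⟩
  -- `a = a' / g ^ m` on `D(g)`, for `L`-points and for the `K`-point `Q`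
  obtain ⟨a', m, hfa⟩ := exists_map_mul_pow_eq_algebraMap hU g a hgV
  have hL := eval_eq_div_of_map_mul_pow_eq (L := L) g a' a hgV m hfa
  have hK := eval_eq_div_of_map_mul_pow_eq (L := K) g a' a hgV m hfa Q hQg
  -- hence the germ of `P ↦ a(P)` is `β a`, whose standard part is `a(P₀)`
  have hgerm : ((evalOrZero V a : AlgPoints X L → L) : K) = ((β a : R) : K) := by
    rw [hβK, hK, hQeval, hQeval, hτ, hτ, ← Germ.coe_pow, ← Germ.coe_div]
    refine Germ.coe_eq.mpr ?_
    filter_upwards [hg𝒰] with P hP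
    rw [Pi.div_apply, Pi.pow_apply, evalOrZero_of_mem a (hgV hP), hL P hP,
      evalOrZero_of_mem a' (hgU hP), evalOrZero_of_mem g (hgU hP)]
  rw [hP₀eval]
  exact tendsto_st 𝒰 L (β a) hgerm

end Main

end AlgPoints

/-! ### The named fact -/

/-- **`X(L)` is compact for `X` proper over `k`** — discharge of the named fact
`Literature.compactSpace_algPoints_of_isProper X L` of `Literature/AlgebraicGeometry/Motives/AlgPoints.lean`:
for `X` proper over `k` and `L ⊇ k` a locally compact non-trivially normed field, `X(L)` with its
strong topology is compact. Proof: `X` is quasi-compact, so every ultrafilter on `X(L)` contains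
some `U(L)` with `U` affine (`AlgPoints.exists_isAffineOpen_setOf_pt_mem_mem`) and therefore
converges (`AlgPoints.exists_ultrafilter_le_nhds`, the valuative criterion for the universally
closed `X → Spec k` applied to the ultrapower `L^𝒰` and its ring of bounded germs). The sources:
Mumford, *Red Book* I §10 Thm. 2 and Serre, GAGA §2 n°7 Prop. 6 (`L = ℂ`, via Chow's lemma);
Conrad, *Weil and Grothendieck approaches to adelic points*, Prop. 2.1 and §5 (local fields).
[cite: MumfordRedBook1999, I.10 Thm. 2] [cite: ConradAdelicPoints2012, Prop. 2.1 and §5]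
[cite: SerreGAGA1956, §2 n°7 Prop. 6] -/
theorem compactSpace_algPoints_of_isProper_holds (X : SchemeOver k) (L : Type u) :
    compactSpace_algPoints_of_isProper X L := by
  intro _ _ _ _
  have : CompactSpace X.left := (quasiCompact_iff_compactSpace X.hom).mp inferInstance
  refine ⟨isCompact_iff_ultrafilter_le_nhds.mpr fun 𝒰 _ ↦ ?_⟩
  obtain ⟨U, hU, hU𝒰⟩ := AlgPoints.exists_isAffineOpen_setOf_pt_mem_mem 𝒰
  obtain ⟨P₀, h⟩ := AlgPoints.exists_ultrafilter_le_nhds 𝒰 hU hU𝒰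
  exact ⟨P₀, Set.mem_univ _, h⟩

end Literature.AlgebraicGeometry.Motives
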